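import Summits.CriticalPhenomena.PercolationContinuityZ3.Theorems.PercNearOneGluingNoHeavyQuantFlowPour
import HarnessLib

/-!
# QUANT lane R8, T-DEC: THE SELECTIVE POUR — moving the giant-routed mass of a CLASS of lows into slot mids they are all compatible with,
# with the column bookkeeping exported (`IsFlowAtT.pourFrom`)

builds on p205010 (kernel theorem, internal audit signed; external expert review pending)

Support file (`--supports stmt-CriticalPhenomena-4575`), QUANT lane seat prim-quant-arm-1 (gen 39), rung R8 of
`run/shared/lean/prim/quant/LADDER.md`.  Theorems only (no definitions), standard axioms, no sorries.  Generalises this seat's `IsFlowAtT.pour`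
(`…QuantFlowPour`): only the lows in a class `good` pour (so the rate bound `usage(l,h) ≤ U h` and the compatibility `T < l + h` are required for
good lows only — e.g. the lows `l ≥ a` refilling the blob atom's vacated mid slots, `rho_le_rho_of_le_low`), the slots may be ANY mids (`T ≤ 2h`),
and the conclusion records the new witness coordinatewise: giant columns of good lows scaled by `1 − κ`, all other giant columns and all rows
unchanged, every mid column loaded by at most `old load + s h`.  Memo TWIN-MOVE-G39 §9–§10 (the two-pour competitor for the residual (R1)).

* **`LawDec.IsFlowAtT.pourFrom`**.

[this work]; nothing here is cited as a published result.  The gluing rows served [cite: KozmaNitzan2024, Conjecture 3 (p. 15)]; product measure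
[cite: Grimmett1999, §1.3 p. 10].
-/

noncomputable section

namespace Summit.CriticalPhenomena.PercolationContinuityZ3.Theorems

namespace Quant

open Finset

namespace LawDec

/-- **THE SELECTIVE POUR.**  `φ` a flow witness of `Q` at `(x, T, j, M)`; `good` a class of lows; slots `h` (`s h > 0`) are mids `h ≤ j`,
`h ≤ M`, `T ≤ 2h`, compatible with every good low (`T < l + h`), not over-full (`load h + s h ≤ Q h`), where good lows pay at most `U h`;
`W = ` giant-routed mass of the good lows, `F = Σ s h / U h`, `0 ≤ κ ≤ 1`, `κ·W ≤ F`.  Then the witness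
`φ′ l h = φ l h + [good l]·κ·G l·(s h/U h)/F` off the giants, `(1 − [good l]κ)·φ l h` on the giants, is a flow witness of `Q` with: good giant
columns scaled by `1−κ`, other giant columns unchanged, mid columns loaded by at most `load + s h`. [this work] -/
theorem IsFlowAtT.pourFrom {x T : ℝ} {j M : ℕ} {Q : ℕ → ℝ} {φ : ℕ → ℕ → ℝ} (hφ : IsFlowAtT x T j M Q φ)
    (hx0 : 0 < x) (hx1 : x < 1) (good : ℕ → Prop) [DecidablePred good] (s U : ℕ → ℝ) (hs0 : ∀ h, 0 ≤ s h) (hU : ∀ h, 0 < U h)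
    (hslot : ∀ h, 0 < s h → h ≤ j ∧ h ≤ M ∧ T ≤ 2 * (h : ℝ))
    (hcompat : ∀ l h, 0 < s h → good l → l ≤ j → 2 * (l : ℝ) < T → T < (l : ℝ) + h)
    (hspare : ∀ h, 0 < s h → ∑ l ∈ Finset.range (j + 1), usage x T j l h * φ l h + s h ≤ Q h)
    (hrate : ∀ l h, 0 < s h → good l → l ≤ j → 2 * (l : ℝ) < T → usage x T j l h ≤ U h)
    (κ : ℝ) (hκ0 : 0 ≤ κ) (hκ1 : κ ≤ 1)
    (hκF : κ * ∑ l ∈ Finset.range (j + 1), (if good l then ∑ g ∈ Finset.Ico (j + 1) (M + 1), φ l g else 0)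
      ≤ ∑ h ∈ Finset.range (M + 1), s h / U h) :
    IsFlowAtT x T j M Q (fun l h => if j + 1 ≤ h then (1 - (if good l then κ else 0)) * φ l h
      else φ l h + (if good l then κ else 0) * (∑ g ∈ Finset.Ico (j + 1) (M + 1), φ l g) * (s h / U h)
        / (∑ h' ∈ Finset.range (M + 1), s h' / U h')) ∧
    (∀ h, ¬ (j + 1 ≤ h) → ∑ l ∈ Finset.range (j + 1), usage x T j l h *
        (fun l h => if j + 1 ≤ h then (1 - (if good l then κ else 0)) * φ l h
          else φ l h + (if good l then κ else 0) * (∑ g ∈ Finset.Ico (j + 1) (M + 1), φ l g) * (s h / U h)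
            / (∑ h' ∈ Finset.range (M + 1), s h' / U h')) l h
      ≤ ∑ l ∈ Finset.range (j + 1), usage x T j l h * φ l h + s h) := by
  classical
  obtain ⟨hφ0, hsupp, hrow, hcol⟩ := hφ
  set kk : ℕ → ℝ := fun l => if good l then κ else 0 with hkk
  set W : ℝ := ∑ l ∈ Finset.range (j + 1), (if good l then ∑ g ∈ Finset.Ico (j + 1) (M + 1), φ l g else 0) with hW
  set F : ℝ := ∑ h ∈ Finset.range (M + 1), s h / U h with hF
  set G : ℕ → ℝ := fun l => ∑ g ∈ Finset.Ico (j + 1) (M + 1), φ l g with hG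
  set φ' : ℕ → ℕ → ℝ := fun l h => if j + 1 ≤ h then (1 - kk l) * φ l h else φ l h + kk l * G l * (s h / U h) / F with hφ'
  have hG0 : ∀ l, 0 ≤ G l := fun l => Finset.sum_nonneg fun g _ => hφ0 l g
  have hkk0 : ∀ l, 0 ≤ kk l := fun l => by simp only [hkk]; split_ifs; exacts [hκ0, le_rfl]
  have hkk1 : ∀ l, kk l ≤ 1 := fun l => by simp only [hkk]; split_ifs; exacts [hκ1, zero_le_one]
  have hkkκ : ∀ l, kk l ≤ κ := fun l => by simp only [hkk]; split_ifs; exacts [le_rfl, hκ0]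
  have hF0 : 0 ≤ F := Finset.sum_nonneg fun h _ => div_nonneg (hs0 h) (hU h).le
  have hW0 : 0 ≤ W := Finset.sum_nonneg fun l _ => by split_ifs; exacts [hG0 l, le_rfl]
  have hextra0 : ∀ l h, 0 ≤ kk l * G l * (s h / U h) / F := fun l h =>
    div_nonneg (mul_nonneg (mul_nonneg (hkk0 l) (hG0 l)) (div_nonneg (hs0 h) (hU h).le)) hF0
  -- a low with positive giant mass is a genuine low
  have hGlow : ∀ l, 0 < G l → l ≤ j ∧ 2 * (l : ℝ) < T := by
    intro l hl
    obtain ⟨g, hg, hpos⟩ := Finset.exists_lt_of_sum_lt (by simpa [hG] using hl : ∑ g ∈ Finset.Ico (j + 1) (M + 1), (0:ℝ) < ∑ g ∈ Finset.Ico (j + 1) (M + 1), φ l g)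
    obtain ⟨hlj, hlow, _, _⟩ := hsupp l g hpos
    exact ⟨hlj, hlow⟩
  -- the poured load at a slot is at most `s h`
  have hkkW : ∑ l ∈ Finset.range (j + 1), kk l * G l ≤ κ * W := by
    rw [hW, Finset.mul_sum]
    refine Finset.sum_le_sum fun l _ => ?_
    simp only [hkk]; split_ifs
    · exact le_rfl
    · rw [zero_mul, mul_zero]
  have hpour : ∀ h, ¬ (j + 1 ≤ h) → ∑ l ∈ Finset.range (j + 1), usage x T j l h * (kk l * G l * (s h / U h) / F) ≤ s h := by
    intro h hg
    rcases (hs0 h).eq_or_lt with hz | hsh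
    · rw [← hz]; simp
    · rcases hF0.eq_or_lt with hFz | hFpos
      · -- `F = 0` forces `s h / U h = 0`, i.e. `s h = 0`: contradiction with `0 < s h`
        exfalso
        have hmem : h ∈ Finset.range (M + 1) := Finset.mem_range.2 (by have := (hslot h hsh).2.1; omega)
        have : s h / U h ≤ F := Finset.single_le_sum (fun h' _ => div_nonneg (hs0 h') (hU h').le) hmem
        have : s h / U h ≤ 0 := by rw [← hFz] at this; exact this
        have : 0 < s h / U h := div_pos hsh (hU h)
        linarith
      · have hterm : ∀ l ∈ Finset.range (j + 1), usage x T j l h * (kk l * G l * (s h / U h) / F) ≤ kk l * G l * s h / F := by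
          intro l hl
          rcases (hG0 l).eq_or_lt with hz | hGl
          · rw [← hz]; simp
          · rcases (hkk0 l).eq_or_lt with hz2 | hkpos
            · rw [← hz2]; simp
            · have hgood : good l := by
                by_contra hng; simp only [hkk, if_neg hng] at hkpos; exact lt_irrefl _ hkpos
              obtain ⟨hlj, hlow⟩ := hGlow l hGl
              have hu := hrate l h hsh hgood hlj hlow
              have hc := hcompat l h hsh hgood hlj hlow
              have hlh : l < h := by
                have : (l : ℝ) < h := by linarith
                exact_mod_cast this
              have hu0 : 0 ≤ usage x T j l h := (usage_pos_of_compat x T j l h hx0 hx1 hlow hlh (Or.inr hc)).le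
              have hUh := hU h
              calc usage x T j l h * (kk l * G l * (s h / U h) / F)
                  = (usage x T j l h / U h) * (kk l * G l * s h / F) := by field_simp
                _ ≤ 1 * (kk l * G l * s h / F) :=
                    mul_le_mul_of_nonneg_right ((div_le_one hUh).2 hu)
                      (div_nonneg (mul_nonneg (mul_nonneg hkpos.le hGl.le) (hs0 h)) hF0)
                _ = kk l * G l * s h / F := one_mul _
        refine (Finset.sum_le_sum hterm).trans ?_
        have e3 : ∑ l ∈ Finset.range (j + 1), kk l * G l * s h / F = (∑ l ∈ Finset.range (j + 1), kk l * G l) * s h / F := by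
          rw [Finset.sum_mul, Finset.sum_div]
        rw [e3, div_le_iff₀ hFpos]
        have := mul_le_mul_of_nonneg_right (hkkW.trans hκF) (hs0 h)
        linarith
  refine ⟨⟨fun l h => ?_, fun l h hp => ?_, fun l hlj hlow => ?_, fun h hhM habs => ?_⟩, fun h hg => ?_⟩
  · -- nonnegativity
    show 0 ≤ φ' l h
    simp only [hφ']
    split_ifs
    · exact mul_nonneg (by linarith [hkk1 l]) (hφ0 l h)
    · exact add_nonneg (hφ0 l h) (hextra0 l h)
  · -- support of charged pairs
    change 0 < φ' l h at hp
    simp only [hφ'] at hp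
    by_cases hg : j + 1 ≤ h
    · rw [if_pos hg] at hp
      have : 0 < φ l h := by
        by_contra hle
        have : φ l h = 0 := le_antisymm (not_lt.1 hle) (hφ0 l h)
        rw [this, mul_zero] at hp; exact lt_irrefl _ hp
      exact hsupp l h this
    · rw [if_neg hg] at hp
      rcases (hφ0 l h).eq_or_lt with hz | hpos
      · rw [← hz, zero_add] at hp
        have hsh : 0 < s h := by
          by_contra hle
          have : s h = 0 := le_antisymm (not_lt.1 hle) (hs0 h)
          rw [this, zero_div, mul_zero, zero_div] at hp; exact lt_irrefl _ hp
        have hGl : 0 < G l := by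
          by_contra hle
          have : G l = 0 := le_antisymm (not_lt.1 hle) (hG0 l)
          rw [this, mul_zero, zero_mul, zero_div] at hp; exact lt_irrefl _ hp
        have hgood : good l := by
          by_contra hng
          simp only [hkk, if_neg hng, zero_mul, zero_div] at hp; exact lt_irrefl _ hp
        obtain ⟨hhj, hhM, _⟩ := hslot h hsh
        obtain ⟨hlj, hlow⟩ := hGlow l hGl
        exact ⟨hlj, hlow, hhM, Or.inr (hcompat l h hsh hgood hlj hlow)⟩
      · exact hsupp l h hpos
  · -- rows
    show ∑ h ∈ Finset.range (M + 1), φ' l h = Q l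
    have hsplit : ∑ h ∈ Finset.range (M + 1), φ' l h
        = ∑ h ∈ Finset.range (M + 1), φ l h
          + (∑ h ∈ Finset.range (M + 1), (if j + 1 ≤ h then -(kk l * φ l h) else kk l * G l * (s h / U h) / F)) := by
      rw [← Finset.sum_add_distrib]
      refine Finset.sum_congr rfl fun h _ => ?_
      simp only [hφ']
      split_ifs <;> ring
    have hcorr : ∑ h ∈ Finset.range (M + 1), (if j + 1 ≤ h then -(kk l * φ l h) else kk l * G l * (s h / U h) / F) = 0 := by
      have e : ∀ h ∈ Finset.range (M + 1), (if j + 1 ≤ h then -(kk l * φ l h) else kk l * G l * (s h / U h) / F)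
          = (if j + 1 ≤ h then -(kk l * φ l h) else 0) + (kk l * G l / F) * (if j + 1 ≤ h then 0 else s h / U h) := by
        intro h _; split_ifs <;> ring
      rw [Finset.sum_congr rfl e, Finset.sum_add_distrib, ← Finset.mul_sum]
      have e1 : ∑ h ∈ Finset.range (M + 1), (if j + 1 ≤ h then -(kk l * φ l h) else 0) = -(kk l * G l) := by
        rw [← Finset.sum_filter]
        have : (Finset.range (M + 1)).filter (fun h => j + 1 ≤ h) = Finset.Ico (j + 1) (M + 1) := by
          ext h; simp only [Finset.mem_filter, Finset.mem_range, Finset.mem_Ico]; omega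
        rw [this, hG, Finset.mul_sum, ← Finset.sum_neg_distrib]
      have e2 : ∑ h ∈ Finset.range (M + 1), (if j + 1 ≤ h then 0 else s h / U h) = F := by
        rw [hF]
        refine Finset.sum_congr rfl fun h _ => ?_
        split_ifs with hg
        · rcases (hs0 h).eq_or_lt with hz | hpos
          · rw [← hz, zero_div]
          · have := (hslot h hpos).1; omega
        · rfl
      rw [e1, e2]
      rcases hF0.eq_or_lt with hFz | hFpos
      · -- with `F = 0`, `kk l * G l ≤ κ W ≤ F = 0`
        have h1 : kk l * G l ≤ κ * W := by
          by_cases hl : l ∈ Finset.range (j + 1)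
          · exact (Finset.single_le_sum (fun l' _ => mul_nonneg (hkk0 l') (hG0 l')) hl).trans hkkW
          · -- `l > j`: then `G l = 0` (no charged pair out of a non-low)
            have : G l = 0 := Finset.sum_eq_zero fun g _ => by
              by_contra hne
              have := (hsupp l g (lt_of_le_of_ne (hφ0 l g) (Ne.symm hne))).1
              exact hl (Finset.mem_range.2 (by omega))
            rw [this, mul_zero]; exact mul_nonneg hκ0 hW0
        have h2 : κ * W ≤ 0 := by rw [← hFz] at hκF; exact hκF
        have h3 : 0 ≤ kk l * G l := mul_nonneg (hkk0 l) (hG0 l)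
        have h4 : kk l * G l = 0 := le_antisymm (h1.trans h2) h3
        rw [← hFz, mul_zero, add_zero, h4, neg_zero]
      · field_simp
        ring
    rw [hsplit, hcorr, add_zero]
    exact hrow l hlj hlow
  · -- columns
    show ∑ l ∈ Finset.range (j + 1), usage x T j l h * φ' l h ≤ Q h
    by_cases hg : j + 1 ≤ h
    · have e : ∀ l ∈ Finset.range (j + 1), usage x T j l h * φ' l h ≤ usage x T j l h * φ l h := by
        intro l _
        simp only [hφ', if_pos hg]
        rw [usage_giant_eq x T j l h hg]
        have hu : 0 ≤ x / (1 - x) := div_nonneg hx0.le (by linarith)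
        calc x / (1 - x) * ((1 - kk l) * φ l h) = (1 - kk l) * (x / (1 - x) * φ l h) := by ring
          _ ≤ 1 * (x / (1 - x) * φ l h) := mul_le_mul_of_nonneg_right (by linarith [hkk0 l]) (mul_nonneg hu (hφ0 l h))
          _ = x / (1 - x) * φ l h := one_mul _
      exact (Finset.sum_le_sum e).trans (hcol h hhM habs)
    · have e : ∑ l ∈ Finset.range (j + 1), usage x T j l h * φ' l h
          = ∑ l ∈ Finset.range (j + 1), usage x T j l h * φ l h
            + ∑ l ∈ Finset.range (j + 1), usage x T j l h * (kk l * G l * (s h / U h) / F) := by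
        rw [← Finset.sum_add_distrib]
        refine Finset.sum_congr rfl fun l _ => ?_
        simp only [hφ', if_neg hg]; ring
      rw [e]
      rcases (hs0 h).eq_or_lt with hz | hsh
      · have : ∑ l ∈ Finset.range (j + 1), usage x T j l h * (kk l * G l * (s h / U h) / F) = 0 :=
          Finset.sum_eq_zero fun l _ => by rw [← hz]; simp
        rw [this, add_zero]; exact hcol h hhM habs
      · have := hpour h hg
        have := hspare h hsh
        linarith
  · -- exported mid-column bound
    show ∑ l ∈ Finset.range (j + 1), usage x T j l h * φ' l h ≤ ∑ l ∈ Finset.range (j + 1), usage x T j l h * φ l h + s h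
    have e : ∑ l ∈ Finset.range (j + 1), usage x T j l h * φ' l h
        = ∑ l ∈ Finset.range (j + 1), usage x T j l h * φ l h
          + ∑ l ∈ Finset.range (j + 1), usage x T j l h * (kk l * G l * (s h / U h) / F) := by
      rw [← Finset.sum_add_distrib]
      refine Finset.sum_congr rfl fun l _ => ?_
      simp only [hφ', if_neg hg]; ring
    rw [e]
    linarith [hpour h hg]

end LawDec

end Quant

end Summit.CriticalPhenomena.PercolationContinuityZ3.Theorems
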